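import Summits.HodgeConjecture.HodgeConjecture.Theorems.F0P3cStCharTSCayleyChartHaar   -- ★ (C4) p851851: `valBound_of_mem_level_zero`, `level_antitone`, `isOpen_level`, `exists_level_subset_of_mem_nhds`
import HarnessLib

/-!
# F0 · P3c · line LH6 «StCharTS» — WIF antecedent, ELLIPTIC half: brick (Q11) «LEVEL SHIFT OF CONTINUOUS EQUIVARIANT ADDITIVE MAPS» —
# a continuous additive map commuting with the scaling by a uniformiser moves the levels `Λ (j + d)` into `Λ j` for ONE `d` and ALL `j`

Cell `pub/hodgecm-mathlib`, crux H413 = `stmt-HodgeConjecture-24833` (lane `--supports … --as helper`); seat LH5-p02 (g6); ROAD «JAC-ELL» v1, the qualitative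
replacement of (Q5): in C8b the Newton hypothesis `(N_L)` needs `Λ (j + 1 + k) ⊆ L̃ (Λ′ (j + 1))`, i.e. a UNIFORM level shift for the continuous linear maps `L̃⁻¹`,
`pr_𝔪`, `pr_𝔱` on the Lie algebra — uniformity in `j` comes for free from equivariance under the scaling `Z ↦ π • Z` (`|π| = α`), no eigenvalue estimate needed.
THEOREMS ONLY; Mathlib + ★ (C4).

SETTING (★ C4's abstract frame).  `ι : V →+ Matrix m m K` (closed embedding), levels `Λ j = ι⁻¹{ValBound α^(j+1)}` (`hΛ`), `0 ≠ α < 1`; a SCALING `s : V ≃+ V` with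
`ι (s Z) = π • ι Z`, `valuation K π = α` (on the road: `π` a uniformiser of `F = L⁺_v` acting on the `F`-subspace `𝔲`); `f : V →+ V` continuous with `f ∘ s = s ∘ f`.
* `s_mem_level_succ_iff`, `iterate_s_mem_level_iff`, `iterate_symm_mem_level_iff` — `s` shifts levels by one: `s Z ∈ Λ (j + 1) ↔ Z ∈ Λ j`; `iterate_comm_of_comm`;
* `exists_level_subset_preimage` — continuity at `0`: `Λ d ⊆ f ⁻¹ (Λ 0)` for some `d`;
* **`exists_uniform_level_shift`** — `∃ d, ∀ j, ∀ Z ∈ Λ (j + d), f Z ∈ Λ j` (scale down by `s^j`, apply the `d` of level `0`, scale back);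
* `exists_uniform_level_shift₂` — the same for two maps at once (common `d`), the form C8b uses for `(pr_𝔪, pr_𝔱)` and for `L̃⁻¹`.

HONEST LABEL: HC_CM is proved only modulo the 7 printed citations (2 remaining named inputs: hLiu418 = `stmt-HodgeConjecture-24832`, h413 =
`stmt-HodgeConjecture-24833`) until rung 0 closes; this file closes no organ.

## References
* [Serre1992LALG] J.-P. Serre, *Lie Algebras and Lie Groups*, LNM 1500 (1992), Part II Ch. IV §9 (filtrations of standard groups). Context locator.
-/

set_option autoImplicit false
set_option linter.dupNamespace false

open Set Filter Topology Matrix ValuativeRel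
open Literature.NumberTheory.Automorphic
open Summit.HodgeConjecture.HodgeConjecture.Cruxes.H413.F0P3cStCharTSCayleyChartHaar
open scoped Topology

namespace Summit.HodgeConjecture.HodgeConjecture.Cruxes.H413.F0P3cStCharTSLevelShift

section Scaling

variable {K : Type*} [Field K] [ValuativeRel K] {m : Type*} {V : Type*} [AddCommGroup V]
  (ι : V →+ Matrix m m K) (Λ : ℕ → AddSubgroup V) {α : ValueGroupWithZero K} (s : V ≃+ V) {π : K}

/-- Scaling an entrywise bound: `ValBound γ X → ValBound (|π|·γ) (π • X)`. [cite: Serre1992LALG, Part II Ch. IV §9] -/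
theorem valBound_smul_of_valBound {γ : ValueGroupWithZero K} {X : Matrix m m K} (hX : ValBound γ X) :
    ValBound (valuation K π * γ) (π • X) := fun i j => by
  rw [Matrix.smul_apply, smul_eq_mul, map_mul]
  exact mul_le_mul' le_rfl (hX i j)

/-- **The scaling shifts levels by one**: `s Z ∈ Λ (j + 1) ↔ Z ∈ Λ j` (`|π| = α ≠ 0`). [cite: Serre1992LALG, Part II Ch. IV §9] -/
theorem s_mem_level_succ_iff (hΛ : ∀ j X, X ∈ Λ j ↔ ValBound (α ^ (j + 1)) (ι X)) (hs : ∀ Z, ι (s Z) = π • ι Z)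
    (hπ : valuation K π = α) (hα : α ≠ 0) (j : ℕ) (Z : V) : s Z ∈ Λ (j + 1) ↔ Z ∈ Λ j := by
  rw [hΛ, hΛ, hs, pow_succ' α (j + 1)]
  constructor
  · intro h i k
    have hik := h i k
    rw [Matrix.smul_apply, smul_eq_mul, map_mul, hπ] at hik
    have := mul_le_mul' (le_refl α⁻¹) hik
    rwa [inv_mul_cancel_left₀ hα, inv_mul_cancel_left₀ hα] at this
  · intro h i k
    rw [Matrix.smul_apply, smul_eq_mul, map_mul, hπ]
    exact mul_le_mul' (le_refl α) (h i k)

/-- Iterating: `s^[n] Z ∈ Λ (j + n) ↔ Z ∈ Λ j`. [cite: Serre1992LALG, Part II Ch. IV §9] -/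
theorem iterate_s_mem_level_iff (hΛ : ∀ j X, X ∈ Λ j ↔ ValBound (α ^ (j + 1)) (ι X)) (hs : ∀ Z, ι (s Z) = π • ι Z)
    (hπ : valuation K π = α) (hα : α ≠ 0) (n j : ℕ) (Z : V) : s^[n] Z ∈ Λ (j + n) ↔ Z ∈ Λ j := by
  induction n generalizing Z with
  | zero => simp
  | succ n ih =>
    rw [Function.iterate_succ', Function.comp_apply, show j + (n + 1) = (j + n) + 1 by omega,
      s_mem_level_succ_iff ι Λ s hΛ hs hπ hα, ih]

/-- Iterating the inverse: `(s.symm)^[n] Z ∈ Λ j ↔ Z ∈ Λ (j + n)`. [cite: Serre1992LALG, Part II Ch. IV §9] -/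
theorem iterate_symm_mem_level_iff (hΛ : ∀ j X, X ∈ Λ j ↔ ValBound (α ^ (j + 1)) (ι X)) (hs : ∀ Z, ι (s Z) = π • ι Z)
    (hπ : valuation K π = α) (hα : α ≠ 0) (n j : ℕ) (Z : V) : s.symm^[n] Z ∈ Λ j ↔ Z ∈ Λ (j + n) := by
  have h := iterate_s_mem_level_iff ι Λ s hΛ hs hπ hα n j (s.symm^[n] Z)
  have hss : s^[n] (s.symm^[n] Z) = Z := by
    have : Function.LeftInverse s s.symm := s.apply_symm_apply
    exact (this.iterate n) Z
  rw [hss] at h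
  exact h.symm

/-- A map commuting with `s` commutes with its iterates and with the iterates of `s.symm`. [cite: Serre1992LALG, Part II Ch. IV §9] -/
theorem iterate_comm_of_comm {f : V → V} (hfs : ∀ Z, f (s Z) = s (f Z)) (n : ℕ) (Z : V) :
    f (s^[n] Z) = s^[n] (f Z) ∧ f (s.symm^[n] Z) = s.symm^[n] (f Z) := by
  have hfs' : ∀ Z, f (s.symm Z) = s.symm (f Z) := fun Z => by
    apply s.injective
    rw [← hfs, s.apply_symm_apply, s.apply_symm_apply]
  induction n generalizing Z with
  | zero => simp
  | succ n ih =>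
    constructor
    · rw [Function.iterate_succ', Function.comp_apply, Function.comp_apply, hfs, (ih _).1]
    · rw [Function.iterate_succ', Function.comp_apply, Function.comp_apply, hfs', (ih _).2]

end Scaling

section Shift

variable {K : Type*} [Field K] [ValuativeRel K] [TopologicalSpace K] [IsNonarchimedeanLocalField K]
  {m : Type*} [Fintype m] {V : Type*} [AddCommGroup V] [TopologicalSpace V] [T2Space V]
  (ι : V →+ Matrix m m K) (Λ : ℕ → AddSubgroup V) {α : ValueGroupWithZero K} (s : V ≃+ V) {π : K}

/-- **Continuity at `0` in level form**: a map continuous at `0` with `f 0 = 0` sends some level `Λ d` into `Λ 0`. [cite: Serre1992LALG, Part II Ch. IV §9] -/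
theorem exists_level_subset_preimage (hι : IsClosedEmbedding ι) (hΛ : ∀ j X, X ∈ Λ j ↔ ValBound (α ^ (j + 1)) (ι X)) (hα : α ≠ 0) (hα1 : α < 1)
    {f : V → V} (hf : ContinuousAt f 0) (hf0 : f 0 = 0) (j₀ : ℕ) : ∃ d, ∀ Z ∈ Λ d, f Z ∈ Λ j₀ := by
  have hopen := isOpen_level ι Λ hι.continuous hΛ hα j₀
  have hmem : f ⁻¹' (Λ j₀ : Set V) ∈ 𝓝 (0 : V) := hf.preimage_mem_nhds (by rw [hf0]; exact hopen.mem_nhds (zero_mem _))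
  obtain ⟨d, hd⟩ := exists_level_subset_of_mem_nhds ι Λ hι hΛ hα1 _ hmem
  exact ⟨d, fun Z hZ => hd hZ⟩

/-- **UNIFORM LEVEL SHIFT**: a continuous-at-`0` additive-like map (`f 0 = 0`) commuting with the scaling `s` (`ι ∘ s = π • ι`, `|π| = α`) satisfies
`f (Λ (j + d)) ⊆ Λ j` for ONE `d` and ALL `j`. [cite: Serre1992LALG, Part II Ch. IV §9] -/
theorem exists_uniform_level_shift (hι : IsClosedEmbedding ι) (hΛ : ∀ j X, X ∈ Λ j ↔ ValBound (α ^ (j + 1)) (ι X)) (hα : α ≠ 0) (hα1 : α < 1)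
    (hs : ∀ Z, ι (s Z) = π • ι Z) (hπ : valuation K π = α)
    {f : V → V} (hf : ContinuousAt f 0) (hf0 : f 0 = 0) (hfs : ∀ Z, f (s Z) = s (f Z)) :
    ∃ d, ∀ j, ∀ Z ∈ Λ (j + d), f Z ∈ Λ j := by
  obtain ⟨d, hd⟩ := exists_level_subset_preimage ι Λ hι hΛ hα hα1 hf hf0 0
  refine ⟨d, fun j Z hZ => ?_⟩
  -- scale down: `Z' := s.symm^[j] Z ∈ Λ d`
  have hZ' : s.symm^[j] Z ∈ Λ d := (iterate_symm_mem_level_iff ι Λ s hΛ hs hπ hα j d Z).2 (by rwa [add_comm])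
  have hfZ' : f (s.symm^[j] Z) ∈ Λ 0 := hd _ hZ'
  -- scale back: `f Z = s^[j] (f Z')`
  have hback : s^[j] (f (s.symm^[j] Z)) = f Z := by
    rw [← (iterate_comm_of_comm s hfs j _).1]
    congr 1
    exact (Function.LeftInverse.iterate s.apply_symm_apply j) Z
  have := (iterate_s_mem_level_iff ι Λ s hΛ hs hπ hα j 0 (f (s.symm^[j] Z))).2 hfZ'
  rwa [zero_add, hback] at this

/-- Two maps at once (common shift `d`), the shape C8b uses for `(pr_𝔪, pr_𝔱)` and for `(L̃⁻¹, ·)`. [cite: Serre1992LALG, Part II Ch. IV §9] -/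
theorem exists_uniform_level_shift₂ (hι : IsClosedEmbedding ι) (hΛ : ∀ j X, X ∈ Λ j ↔ ValBound (α ^ (j + 1)) (ι X)) (hα : α ≠ 0) (hα1 : α < 1)
    (hs : ∀ Z, ι (s Z) = π • ι Z) (hπ : valuation K π = α)
    {f g : V → V} (hf : ContinuousAt f 0) (hf0 : f 0 = 0) (hfs : ∀ Z, f (s Z) = s (f Z))
    (hg : ContinuousAt g 0) (hg0 : g 0 = 0) (hgs : ∀ Z, g (s Z) = s (g Z)) :
    ∃ d, ∀ j, ∀ Z ∈ Λ (j + d), f Z ∈ Λ j ∧ g Z ∈ Λ j := by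
  obtain ⟨d₁, h₁⟩ := exists_uniform_level_shift ι Λ s hι hΛ hα hα1 hs hπ hf hf0 hfs
  obtain ⟨d₂, h₂⟩ := exists_uniform_level_shift ι Λ s hι hΛ hα hα1 hs hπ hg hg0 hgs
  have hanti := level_antitone ι Λ hΛ hα1.le
  refine ⟨max d₁ d₂, fun j Z hZ => ⟨h₁ j Z (hanti (by omega) hZ), h₂ j Z (hanti (by omega) hZ)⟩⟩

end Shift

end Summit.HodgeConjecture.HodgeConjecture.Cruxes.H413.F0P3cStCharTSLevelShift
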